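import Literature.AnabelianGeometry.AbsoluteAnabelian.GaloisCyclotomeAction
import Literature.AnabelianGeometry.AbsoluteAnabelian.AbsTopIII.CuspidalSynchronization
import HarnessLib

/-!
# [AbsTopIII] Cor. 1.10 (i)(a), (ii)(c): the Galois cyclotome as a topological module; cyclotomic synchronization

Mochizuki, *Topics in Absolute Anabelian Geometry III*, §1 (manuscript pages, lit key
`paper:url-5493eb38cbb7`):

* Cor. 1.10 (i)(a) p. 42: "one constructs the natural isomorphism `H²(G_k, μ_Ẑ(G_k)) ⥲ Ẑ`
  'group-theoretically' from `G_k`"; (i)(b): "the surjection `H¹(G_k, μ_Ẑ(G_k)) ⥲ G_k^ab ↠ G^unr ⥲ Ẑ`".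
* Cor. 1.10 (ii)(c) p. 42: "One constructs the natural isomorphism `μ_Ẑ(G_k) ⥲ μ_Ẑ(Π_X)`" (the
  "cyclotomic synchronization" of Rmk. 1.10.3 (i)).

Both relate objects that are now REAL in the tree: `μ_Ẑ(G)` (`muZhat`, with its `G`-action,
files `GaloisCyclotome*.lean`), `M_X = μ_Ẑ(Π_X)` (`CyclotomeMod`, with its `Π_X`-action,
`GeometricCyclotome*.lean`) and the cuspidal inertia groups `I_z` of the interface.  This file

* gives `μ_Ẑ(G)` its (profinite) topology — `μ_{ℚ/ℤ}(G)` discrete, `μ_Ẑ(G) ⊆ ∏_n μ_{ℚ/ℤ}(G)` the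
  subspace topology — and packages the conjugation action as a Mathlib continuous representation
  `galCyclotomeRep G : ContRepresentation ℤ G (MuZhatMod G)`, whence the REAL `H²(G, μ_Ẑ(G))`
  (`galCyclotomeH2 G`, continuous cohomology);
* types the statements as NAMED FACTS in junk-safe shapes: `Cor_1_10_i_a` is a transport
  statement about the real `Gal(k̄/k)` of an MLF, as is `Cor_1_10_i_b` (`H¹(G_k, μ_Ẑ(G_k)) ≅ G_k^ab`); `CurveModel.Cor_1_10_ii_c` is relative to a model
  `M : CurveModel` (Thm. 1.9 (b) is the sibling file `CuspidalSynchronization.lean`).  Only the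
  EXISTENCE of an (equivariant) isomorphism is asserted — the NATURAL isomorphism of the text
  (positive rational structure and Frobenius, [AbsAnab] Lem. 2.5) is not singled out (recorded
  limitation).
HONEST FRAMING: typed ≠ discharged; nothing here bears on [IUTchIII] Cor. 3.12.
-/

noncomputable section

open CategoryTheory

universe u

namespace Literature.AnabelianGeometry.AbsoluteAnabelian

/-! ### The topology of `μ_Ẑ(G)` and `H²(G, μ_Ẑ(G))` -/

section GalTop

variable (G : Type u) [Group G] [TopologicalSpace G] [IsTopologicalGroup G] [CompactSpace G]

/-- `μ_{ℚ/ℤ}(G)` is a discrete torsion module (like `ℚ/ℤ`): the discrete topology.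
[cite: MochizukiAbsTopIII2015, Cor 1.10 (i) p.41] -/
instance muQZ.instTopologicalSpace : TopologicalSpace (muQZ G) := ⊥

/-- The topology on `μ_{ℚ/ℤ}(G)` is discrete. [cite: MochizukiAbsTopIII2015, Cor 1.10 (i) p.41] -/
instance muQZ.instDiscreteTopology : DiscreteTopology (muQZ G) := ⟨rfl⟩

/-- **`μ_{ℚ/ℤ}(G)` is a discrete `G`-module**: the conjugation action `G × μ_{ℚ/ℤ}(G) → μ_{ℚ/ℤ}(G)` is
jointly continuous for the discrete topology (stabilizers contain the open subgroup a class comes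
from, `muQZ.smul_ofRep_of_mem`). [cite: MochizukiAbsTopIII2015, Cor 1.10 (i) p.42] -/
instance muQZ.instContinuousSMul : ContinuousSMul G (muQZ G) := by
  refine ⟨continuous_iff_continuousAt.2 ?_⟩
  rintro ⟨g₀, z₀⟩
  obtain ⟨U, u, hu, ht, rfl⟩ := muQZ.exists_ofRep z₀
  have hU : IsOpen {g : G | g₀⁻¹ * g ∈ U} :=
    U.isOpen.preimage (continuous_const.mul continuous_id)
  have hev : (fun _ : G × muQZ G => g₀ • muQZ.ofRep U u hu ht) =ᶠ[nhds (g₀, muQZ.ofRep U u hu ht)]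
      fun p => p.1 • p.2 := by
    filter_upwards [prod_mem_nhds (hU.mem_nhds (by simp))
      ((isOpen_discrete {muQZ.ofRep U u hu ht}).mem_nhds rfl)] with p hp
    obtain ⟨hg, hz⟩ := hp
    rw [Set.mem_singleton_iff] at hz
    rw [hz, show p.1 = g₀ * (g₀⁻¹ * p.1) by group, mul_smul, muQZ.smul_ofRep_of_mem U hg hu]
  exact continuousAt_const.congr hev

/-- The conjugation action on `μ_{ℚ/ℤ}(G)` in multiplicative notation is jointly continuous.
[cite: MochizukiAbsTopIII2015, Cor 1.10 (i) p.42] -/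
instance muQZ.instContinuousSMulMultiplicative : ContinuousSMul G (Multiplicative (muQZ G)) :=
  ⟨continuous_ofAdd.comp ((continuous_fst.smul (continuous_toAdd.comp continuous_snd)))⟩

/-- **`μ_Ẑ(G)` is a topological `G`-module**: the action `G × μ_Ẑ(G) → μ_Ẑ(G)` is jointly continuous
(componentwise in `∏_n μ_{ℚ/ℤ}(G)`). [cite: MochizukiAbsTopIII2015, Cor 1.10 (i) p.42] -/
instance muZhat.instContinuousSMul : ContinuousSMul G (muZhat G) := by
  refine ⟨continuous_induced_rng.2 (continuous_pi fun n => ?_)⟩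
  exact (continuous_fst.smul
    ((_root_.continuous_apply n).comp (continuous_subtype_val.comp continuous_snd)))

/-- `μ_Ẑ(G)` written additively, as a type carrying the subspace topology of
`∏_{n} μ_{ℚ/ℤ}(G)` (the profinite topology of `Hom(ℚ/ℤ, μ_{ℚ/ℤ}(G)) = lim_n μ_{ℚ/ℤ}(G)[n]`).
[cite: MochizukiAbsTopIII2015, Cor 1.10 (i) p.41] -/
def MuZhatMod : Type u := Additive (muZhat G)

/-- `μ_Ẑ(G)` is an abelian group. [cite: MochizukiAbsTopIII2015, Cor 1.10 (i) p.41] -/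
instance MuZhatMod.instAddCommGroup : AddCommGroup (MuZhatMod G) :=
  inferInstanceAs (AddCommGroup (Additive (muZhat G)))

/-- The profinite topology of `μ_Ẑ(G)`. [cite: MochizukiAbsTopIII2015, Cor 1.10 (i) p.41] -/
instance MuZhatMod.instTopologicalSpace : TopologicalSpace (MuZhatMod G) :=
  inferInstanceAs (TopologicalSpace (Additive (muZhat G)))

/-- `μ_Ẑ(G)` is a topological abelian group. [cite: MochizukiAbsTopIII2015, Cor 1.10 (i) p.41] -/
instance MuZhatMod.instIsTopologicalAddGroup : IsTopologicalAddGroup (MuZhatMod G) :=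
  inferInstanceAs (IsTopologicalAddGroup (Additive (muZhat G)))

variable {G} in
/-- The identification `MuZhatMod G = μ_Ẑ(G)` (identity, multiplicative view).
[cite: MochizukiAbsTopIII2015, Cor 1.10 (i) p.41] -/
def MuZhatMod.toMuZhat (m : MuZhatMod G) : muZhat G := Additive.toMul m

variable {G} in
/-- The identification `μ_Ẑ(G) = MuZhatMod G` (identity, additive view).
[cite: MochizukiAbsTopIII2015, Cor 1.10 (i) p.41] -/
def MuZhatMod.ofMuZhat (ζ : muZhat G) : MuZhatMod G := Additive.ofMul ζ

variable {G} in
/-- The `n`-th component `μ_Ẑ(G) → μ_{ℚ/ℤ}(G)` is continuous. [cite: MochizukiAbsTopIII2015, Cor 1.10 (i) p.41] -/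
theorem MuZhatMod.continuous_apply (n : ℕ+) :
    Continuous fun m : MuZhatMod G => ((m.toMuZhat : muZhat G) : ℕ+ → Multiplicative (muQZ G)) n :=
  (_root_.continuous_apply n).comp continuous_subtype_val

/-- The action of `g ∈ G` on `μ_Ẑ(G)` (conjugation, `GaloisCyclotomeAction.lean`) as an additive
homomorphism. [cite: MochizukiAbsTopIII2015, Cor 1.10 (i) p.42] -/
def MuZhatMod.actAddHom (g : G) : MuZhatMod G →+ MuZhatMod G where
  toFun m := MuZhatMod.ofMuZhat (g • m.toMuZhat)
  map_zero' := by
    change Additive.ofMul (g • (1 : muZhat G)) = _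
    rw [smul_one]
    rfl
  map_add' m m' := by
    change Additive.ofMul (g • (m.toMuZhat * m'.toMuZhat)) = _
    rw [smul_mul']
    rfl

/-- The action of `g ∈ G` on `μ_Ẑ(G)` as a continuous `ℤ`-linear map.
[cite: MochizukiAbsTopIII2015, Cor 1.10 (i) p.42] -/
def MuZhatMod.act (g : G) : MuZhatMod G →L[ℤ] MuZhatMod G :=
  { (MuZhatMod.actAddHom G g).toIntLinearMap with
    cont := by
      refine continuous_induced_rng.2 (continuous_pi fun n => ?_)
      exact (continuous_of_discreteTopology (f := fun x : Multiplicative (muQZ G) => g • x)).comp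
        (MuZhatMod.continuous_apply n) }

/-- Formula for the action. [cite: MochizukiAbsTopIII2015, Cor 1.10 (i) p.42] -/
@[simp] theorem MuZhatMod.toMuZhat_act (g : G) (m : MuZhatMod G) :
    (MuZhatMod.act G g m).toMuZhat = g • m.toMuZhat :=
  rfl

/-- **`μ_Ẑ(G)` as a continuous representation of `G`** over `ℤ` (for `G = G_k`, `k` an MLF: the
Tate module `Ẑ(1)` with its Galois action, cf. `MLFGaloisCyclotomeIsRootsOfUnity`).
[cite: MochizukiAbsTopIII2015, Cor 1.10 (i) p.42] -/
def galCyclotomeRep : ContRepresentation ℤ G (MuZhatMod G) :=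
  .ofMonoidHom
    { toFun := MuZhatMod.act G
      map_one' := by
        ext m
        change Additive.ofMul ((1 : G) • m.toMuZhat) = m
        rw [one_smul]
        rfl
      map_mul' := fun g h => by
        ext m
        change Additive.ofMul ((g * h) • m.toMuZhat) = Additive.ofMul (g • h • m.toMuZhat)
        rw [mul_smul] }

/-- `μ_Ẑ(G)` in Mathlib's category `TopRep ℤ G`. [cite: MochizukiAbsTopIII2015, Cor 1.10 (i) p.42] -/
abbrev galCyclotomeTopRep : TopRep.{u} ℤ G := TopRep.of (galCyclotomeRep G)

/-- **`H¹(G, μ_Ẑ(G))`** — Mathlib's continuous cohomology in degree `1` (REAL; for `G = G_k`, `k` an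
MLF: "`H¹(G_k, μ_Ẑ(G_k)) ⥲ G_k^ab`", Cor. 1.10 (i)(b)). [cite: MochizukiAbsTopIII2015, Cor 1.10 (i) p.42] -/
abbrev galCyclotomeH1 : TopModuleCat.{u} ℤ := continuousCohomology.{0, u, u} 1 (galCyclotomeTopRep G)

/-- **`H²(G, μ_Ẑ(G))`** — Mathlib's continuous cohomology in degree `2` (a topological `ℤ`-module;
REAL). [cite: MochizukiAbsTopIII2015, Cor 1.10 (i) p.42] -/
abbrev galCyclotomeH2 : TopModuleCat.{u} ℤ := continuousCohomology.{0, u, u} 2 (galCyclotomeTopRep G)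

end GalTop

/-! ### Cor. 1.10 (i)(a), (b): `H²(G_k, μ_Ẑ(G_k)) ≅ Ẑ`, `H¹(G_k, μ_Ẑ(G_k)) ≅ G_k^ab` for an MLF (named facts) -/

namespace AbsTopIII

/-- **Cor. 1.10 (i)(a)** ("one constructs the natural isomorphism `H²(G_k, μ_Ẑ(G_k)) ⥲ Ẑ`
'group-theoretically' from `G_k` via the algorithm described in the proof of [Mzk9], Proposition
1.2.1, (vii)", p. 42; the invariant/residue map of local class field theory composed with the
cyclotomic identifications): for `k` an MLF, the continuous cohomology group `H²(Gal(k̄/k), μ_Ẑ(G_k))`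
of the GROUP-THEORETIC cyclotome is isomorphic to `Ẑ`.  Transport ("(U)") shape over Mathlib's real
absolute Galois group; only existence of an isomorphism of abelian groups is asserted (the natural
one, and its functoriality "up to the index", Rmk. 1.10.1 (iii), are not singled out).  NAMED FACT
(local Tate duality / Brauer group of a local field; not in Mathlib).
[cite: MochizukiAbsTopIII2015, Cor 1.10 (i) p.42] -/
def Cor_1_10_i_a : Prop :=
  ∀ (k : Type u) [Field k] [CharZero k], IsMLF k →
    Nonempty (galCyclotomeH2 (Field.absoluteGaloisGroup k) ≃+ ZHatCoeff.{u})

/-- **Cor. 1.10 (i)(b), first isomorphism** ("By applying the isomorphism of (a) [and the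
cup-product in group cohomology], one constructs the surjection `H¹(G_k, μ_Ẑ(G_k)) ⥲ G_k^ab ↠ G^unr ⥲ Ẑ`
determined by the Frobenius element", p. 42): for `k` an MLF, the continuous cohomology group
`H¹(Gal(k̄/k), μ_Ẑ(G_k))` of the group-theoretic cyclotome is isomorphic to the topological
abelianization `G_k^ab` (Kummer theory `H¹(G_k, Ẑ(1)) = (k^×)^∧` and local reciprocity
`(k^×)^∧ ⥲ G_k^ab`).  Transport ("(U)") shape over Mathlib's real absolute Galois group; existence
only (the Frobenius quotient `G_k^ab ↠ Ẑ` is abc-iut-L4-t4's LCFT form / `Cor_1_10_i` of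
`Reconstruction.lean`).  NAMED FACT (local class field theory).
[cite: MochizukiAbsTopIII2015, Cor 1.10 (i) p.42] -/
def Cor_1_10_i_b : Prop :=
  ∀ (k : Type u) [Field k] [CharZero k], IsMLF k →
    Nonempty (galCyclotomeH1 (Field.absoluteGaloisGroup k) ≃+
      Additive (TopologicalAbelianization (Field.absoluteGaloisGroup k)))

/-! ### Cor. 1.10 (ii)(c) relative to a model -/

namespace CurveModel

variable (M : CurveModel.{u})

/-- **Cor. 1.10 (ii)(c), relative to `M`** ("One constructs the natural isomorphism
`μ_Ẑ(G_k) ⥲ μ_Ẑ(Π_X)`", p. 42 — the cyclotomic synchronization, Rmk. 1.10.3 (i)): for a cofinite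
open `U ⊆ X` of the model over an MLF `k`, with `X` a PROPER scheme-like curve of genus `≥ 2` (so that
`μ_Ẑ(Π_U) := M_X`, Rmk. 1.10.1 (ii)), there is an isomorphism between the GALOIS cyclotome `μ_Ẑ(G_k)`
(`muZhat`, group-theoretic from `G_k = (M.ext U).gal`) and the GEOMETRIC cyclotome `M_X`
(`CyclotomeMod`, group-theoretic from `Π_X`), equivariant for `Π_U` (acting on `μ_Ẑ(G_k)` through
`Π_U ↠ G_k` and conjugation, on `M_X` through `Π_U ↠ Π_X`).  Existence only; NAMED FACT relative to `M`.
-- TODO(general form): arbitrary hyperbolic orbicurves `X` (Rmk. 1.10.1 (ii): pass to a covering that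
is a curve of genus `≥ 2`). [cite: MochizukiAbsTopIII2015, Cor 1.10 (ii) p.42] -/
def Cor_1_10_ii_c (M : CurveModel.{u}) : Prop :=
  ∀ (U X : M.Curve) (h : M.IsCofiniteOpen U X), M.IsScheme U → M.IsScheme X → M.IsProper X →
    2 ≤ M.genus X → IsMLF (M.base U) →
      ∃ φ : MuZhatMod (M.ext U).gal ≃+ CyclotomeMod (M.ext X) ZHatCoeff.{u},
        ∀ (g : (M.ext U).arith) (m : MuZhatMod (M.ext U).gal),
          φ (galCyclotomeRep (M.ext U).gal ((M.ext U).aug g) m) =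
            cyclotomeModRep (M.ext X) ZHatCoeff.{u} ((M.res h).arith g) (φ m)

end CurveModel

end AbsTopIII

end Literature.AnabelianGeometry.AbsoluteAnabelian
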